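/-
PORT (cell pub-hodgecm2, COR-CM = stage 2 of the Hodge ladder): tree copy of the pub-hodgecm package module
`HodgeCM/Geometry/Universe.lean` (package root `run/shared/lean/pub/pub-hodgecm/lean/HodgeCMPerL/`; file md5 b752513e7fe82551ae04d40c7588bee1, 196 lines, as landed
in the package on 2026-08-20).  MECHANICAL REWRITES ONLY (script `work/port.py` of seat planner-pub-hodgecm2-lead-0):
(R1) the package Origin/Copyright comment blocks are replaced by this header; (R2) imports: `HodgeCM.Vendored.H21.<M>` ->
`Literature.<M>` (the vendored modules are byte-identical copies of the tree modules, DIFF-CERT of pub-hodgecm RUN 55),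
`HodgeCM.Vendored.{WeilTypeCM,Hermitian,HodgeStructure}` -> their tree originals, `HodgeCM.<A>.<B>` -> `Summits.HodgeConjecture.CorCM.<A>.<B>` (mirrored paths under `Summits/HodgeConjecture/CorCM/`);
(R3) `namespace HodgeCM` -> `namespace Summit.HodgeConjecture.CorCM` (docstring references `HodgeCM.<Module>` still NAME PACKAGE modules);
(R5) `import HarnessLib`.  Declaration bodies, statements and docstrings are otherwise VERBATIM.
-/
import Summits.HodgeConjecture.CorCM.CM.Basic
import Mathlib.LinearAlgebra.BilinearForm.TensorProduct
import Mathlib.LinearAlgebra.TensorProduct.Tower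
import HarnessLib

/-!
# The geometric universe: primitives of complex algebraic geometry as ONE hypothesis structure

Mathlib (v4.32.0) has no complex abelian varieties, no Betti cohomology of varieties, no cycle
class map and no Picard modular surfaces. The main tree (`lean/Literature/AlgebraicGeometry/…`)
has scheme-level carriers for some of these, but their import closure is 160–1250 files, so they
cannot be vendored into an isolated package (see `HOME/STATUS.md`, "closure sizes").

DESIGN (honest interface, no smuggled existence): every geometric PRIMITIVE the statements need is a
FIELD of the structure `Universe` below — carriers and operations only, no axioms. Every PROPERTY of
these primitives that a proof would use is a separately NAMED proposition `Universe.Fact_…`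
(file `HodgeCM.Geometry.Facts`, listed with print references in `HOME/FACTS.md`) and enters theorems
as an explicit hypothesis. The statements `PerL`, `PeriodThmF`, `W_RK4`, `HC_CM`, … are then honest
`Prop`-valued DEFINITIONS over a universe `U`; the intended model is
`U.Var` = smooth projective varieties over `ℂ`, `U.Coh X k = H^k(X(ℂ), ℚ)` with its Hodge structure,
`U.alg X p` = the `ℚ`-span of classes of codimension-`p` algebraic cycles, `U.cmAV K Φ` = "the" CM
abelian variety of type `(K, Φ)` (simple iff `Φ` primitive; well defined up to isogeny, and the representative
is CHOSEN with `𝓞_K ⊆ End(A_{(K,Φ)})`, e.g. `ℂ^Φ/Φ(𝓞_K)` — M24 `Fact_cmEnd` presupposes CM by the maximal order;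
every other fact about `cmAV` is isogeny-invariant),
`U.pms L ι₁ V Γ` = the compact Picard modular surface `Γ\𝔹²` (`G_U` is anisotropic, so the quotient is already compact, and it is smooth projective for torsion-free congruence `Γ`: PerL v5 tex ll. 70–73, rfwf v3 ll. 203–206 — no cusps, no compactification).

Sources for the shape of each primitive: rfwf v3 §1–2 (follow-ups doc §B.1), PerL v5 §1.3 and Thm 4.4,
the tree's `Literature.AlgebraicGeometry.HodgeTheory.HodgeConjecture` (cycle classes as a `ℚ`-span
inside Hodge classes) and `Motives.WeilTypeCM` (eigen-pieces of a CM action).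
-/

noncomputable section

open scoped TensorProduct

namespace Summit.HodgeConjecture.CorCM

open Literature.AlgebraicGeometry.Motives
open Literature.AlgebraicGeometry.Motives.HodgeStructure (EndAction conj ofRat)

universe u

/-- **The geometric universe.** Fields are PRIMITIVES ONLY (types and operations); all their
properties are the named `Fact_…` propositions of `HodgeCM.Geometry.Facts`. -/
structure Universe where
  /-- smooth projective complex varieties (connected) -/
  Var : Type
  /-- complex dimension -/
  dim : Var → ℕ
  /-- rational Betti cohomology `H^k(X(ℂ), ℚ)` -/
  Coh : Var → ℕ → Type
  [instAddCommGroup : ∀ X k, AddCommGroup (Coh X k)]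
  [instModule : ∀ X k, Module ℚ (Coh X k)]
  [instFinite : ∀ X k, Module.Finite ℚ (Coh X k)]
  /-- the pure Hodge structure of weight `k` on `H^k` -/
  hodge : ∀ X k, HodgeStructure (Coh X k) (k : ℤ)
  /-- the `ℚ`-span of fundamental classes of codimension-`p` algebraic cycles, inside `H^{2p}(X, ℚ)` -/
  alg : ∀ X (p : ℕ), Submodule ℚ (Coh X (2 * p))
  /-- morphisms of varieties `X → Y` -/
  Mor : Var → Var → Type
  /-- identity morphism -/
  idMor : ∀ X, Mor X X
  /-- composition, diagrammatic order: `comp f g = g ∘ f` -/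
  comp : ∀ {X Y Z}, Mor X Y → Mor Y Z → Mor X Z
  /-- pullback `f^* : H^k(Y) → H^k(X)` -/
  pull : ∀ {X Y}, Mor X Y → ∀ k, Coh Y k →ₗ[ℚ] Coh X k
  /-- cup product `H^i ⊗ H^j → H^{i+j}` -/
  cup : ∀ X (i j : ℕ), Coh X i →ₗ[ℚ] Coh X j →ₗ[ℚ] Coh X (i + j)
  /-- trace `H^k(X, ℚ) → ℚ` (the orientation class in degree `k = 2 dim X`, zero otherwise) -/
  tr : ∀ X (k : ℕ), Coh X k →ₗ[ℚ] ℚ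
  /-- binary product of varieties with its projections -/
  prod : Var → Var → Var
  fst : ∀ X Y, Mor (prod X Y) X
  snd : ∀ X Y, Mor (prod X Y) Y
  /-- abelian varieties among the varieties -/
  IsAbelianVariety : Var → Prop
  /-- abelian varieties of CM type (`End⁰(A)` contains a commutative semisimple `ℚ`-algebra of degree `2 dim A`) -/
  IsCMAbelianVariety : Var → Prop
  /-- the CM abelian variety `A_{(K,Φ)}` of a CM type (Shimura–Taniyama), of dimension `[K:ℚ]/2` -/
  cmAV : (K : CMField) → CMType K → Var
  /-- its action `K ↪ End⁰(A_{(K,Φ)})` on `H¹`, by endomorphisms of Hodge structures -/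
  cmAct : ∀ (K : CMField) (Φ : CMType K), EndAction (hodge (cmAV K Φ) 1) K
  /-- the compact (smooth projective; `G_U` anisotropic) Picard modular surface `P_Γ = Γ\𝔹²` of a hermitian
  3-space `(V₃,h)` over `L` of signature `(2,1)` at `ι₁`, `(3,0)` elsewhere, at a torsion-free congruence level -/
  pms : (L : CMField) → (ι₁ : L →+* ℂ) → (V : HermSpace3 L ι₁) → Level V → Var

attribute [instance] Universe.instAddCommGroup Universe.instModule Universe.instFinite

namespace Universe

variable (U : Universe)

/-! ### Complexified cohomology and the derived operations -/

/-- `H^k(X, ℂ) = ℂ ⊗_ℚ H^k(X, ℚ)`. -/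
abbrev CohC (X : U.Var) (k : ℕ) : Type := ℂ ⊗[ℚ] U.Coh X k

/-- complexified pullback -/
def pullC {X Y : U.Var} (f : U.Mor X Y) (k : ℕ) : U.CohC Y k →ₗ[ℂ] U.CohC X k :=
  (U.pull f k).baseChange ℂ

/-- complexified cup product in equal degrees `H^k ⊗ H^k → H^{2k}` (the only shape the quadrilinear
period needs) -/
def cup2C (X : U.Var) (k : ℕ) : LinearMap.BilinMap ℂ (U.CohC X k) (U.CohC X (k + k)) :=
  LinearMap.BilinMap.baseChange ℂ (U.cup X k k)

/-- complexified trace `H^k(X, ℂ) → ℂ` -/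
def trC (X : U.Var) (k : ℕ) : U.CohC X k →ₗ[ℂ] ℂ :=
  (TensorProduct.AlgebraTensorModule.rid ℚ ℂ ℂ).toLinearMap ∘ₗ (U.tr X k).baseChange ℂ

/-- the four-fold cup `(a ∪ b) ∪ (c ∪ d) ∈ H⁴(X, ℂ)` of degree-one classes -/
def quadC (X : U.Var) (a b c d : U.CohC X 1) : U.CohC X 4 :=
  U.cup2C X 2 (U.cup2C X 1 a b) (U.cup2C X 1 c d)

/-- **The quadrilinear period (PerL form)** `∫_X ω₁ ∧ ω₂ ∧ \overline{ω₃ ∧ ω₄}` of four classes in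
`H¹(X, ℂ)`: trace of `(ω₁ ∪ ω₂) ∪ (conj ω₃ ∪ conj ω₄)` (PerL v5 Thm 4.4; rfwf Thm 4.1 / Prop 2.2, verbatim
shape `F₁^*α₁ ∧ F₂^*α₂ ∧ \overline{F₃^*α₃ ∧ F₄^*α₄}`). `conj` is `HodgeStructure.conj = conj ⊗ id`. -/
def period (X : U.Var) (ω : Fin 4 → U.CohC X 1) : ℂ :=
  U.trC X 4 (U.quadC X (ω 0) (ω 1) (conj (ω 2)) (conj (ω 3)))

/-! ### Hodge classes and the Hodge conjecture for one variety -/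

/-- rational Hodge classes `H^{2p}(X, ℚ) ∩ H^{p,p}` [folklore] -/
def hodgeClassesOf (X : U.Var) (p : ℕ) : Submodule ℚ (U.Coh X (2 * p)) :=
  (U.hodge X (2 * p)).hodgeClasses (p : ℤ)

/-- `HC(X)`: every rational Hodge class on `X` is algebraic, in every codimension. [folklore] -/
def HC (X : U.Var) : Prop := ∀ p : ℕ, U.hodgeClassesOf X p ≤ U.alg X p

/-- **COR-CM**: the Hodge conjecture for every CM abelian variety (rfwf v3 Cor. 8.3 `c:cm`, tex l. 447, first clause). -/
@[conjecture]
def HC_CM : Prop := ∀ X : U.Var, U.IsCMAbelianVariety X → U.HC X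

/-! ### CM eigen-lines -/

/-- the `σ`-eigenline of `K` acting on `H¹(A_{(K,Φ)}, ℂ)` (free of rank one over `K ⊗ ℂ`, so each
eigenline is one-dimensional: `Fact_eigenLine_rank`) [folklore] -/
def eigenLine (K : CMField) (Φ : CMType K) (σ : K →+* ℂ) : Submodule ℂ (U.CohC (U.cmAV K Φ) 1) :=
  ⨅ e : K, Module.End.eigenspace (((U.cmAct K Φ).ι e).baseChange ℂ) (σ e)

/-- the **holomorphic** `σ`-eigen one-forms `H^{1,0}(A_{(K,Φ)})_σ` (nonzero iff `σ ∈ Φ`: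
`Fact_alphaLine`); PerL's `α_t` = "the `φ₁`-eigen-differential of `B_t`" spans `alphaLine K t φ₁`. [folklore] -/
def alphaLine (K : CMField) (Φ : CMType K) (σ : K →+* ℂ) : Submodule ℂ (U.CohC (U.cmAV K Φ) 1) :=
  (U.cmAct K Φ).eigenPiece σ 1 0

/-! ### The product of the four corners and its Weil line -/

/-- `P = A_{Φ₀} × A_{Φ₁} × A_{Φ₂} × A_{Φ₃}` (left-nested binary products). (An `abbrev` since gen 4, so that
rewriting sees through it; the term is unchanged.) -/
abbrev prod4 (K : CMField) (Φ : Fin 4 → CMType K) : U.Var :=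
  U.prod (U.prod (U.prod (U.cmAV K (Φ 0)) (U.cmAV K (Φ 1))) (U.cmAV K (Φ 2))) (U.cmAV K (Φ 3))

/-- the four projections `prᵢ : P → A_{Φᵢ}` -/
def pr4 (K : CMField) (Φ : Fin 4 → CMType K) : (i : Fin 4) → U.Mor (U.prod4 K Φ) (U.cmAV K (Φ i))
  | 0 => U.comp (U.fst _ _) (U.comp (U.fst _ _) (U.fst _ _))
  | 1 => U.comp (U.fst _ _) (U.comp (U.fst _ _) (U.snd _ _))
  | 2 => U.comp (U.fst _ _) (U.snd _ _)
  | 3 => U.snd _ _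

/-- Generators of the complexified **Weil line** `W_K(P) ⊗ ℂ = ⊕_σ ⋀⁴ H¹(P, ℂ)_σ`: the classes
`pr₀^*y₀ ∪ pr₁^*y₁ ∪ pr₂^*y₂ ∪ pr₃^*y₃` with all four `yᵢ` in the SAME eigencharacter `σ`
(rfwf Def 1.1: `W_K(P) := ⋀⁴_K H¹(P, ℚ)`, `H¹(P, ℚ) = ⊕ H¹(A_{Φᵢ}, ℚ)` free of rank 4 over `K`; this
rendering uses the Künneth/cup description, cf. the tree's `Motives.WeilTypeCM.weilClasses`). [folklore] -/
def weilGenerators (K : CMField) (Φ : Fin 4 → CMType K) : Set (U.CohC (U.prod4 K Φ) 4) :=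
  {x | ∃ (σ : K →+* ℂ) (y : (i : Fin 4) → U.CohC (U.cmAV K (Φ i)) 1),
      (∀ i, y i ∈ U.eigenLine K (Φ i) σ) ∧
      x = U.quadC _ (U.pullC (U.pr4 K Φ 0) 1 (y 0)) (U.pullC (U.pr4 K Φ 1) 1 (y 1))
            (U.pullC (U.pr4 K Φ 2) 1 (y 2)) (U.pullC (U.pr4 K Φ 3) 1 (y 3))}

/-- **The Weil line** `W_K(P) ⊂ H⁴(P, ℚ)`: rational classes whose complexification lies in the span of
the Weil generators (a `K`-line, `dim_ℚ = [K:ℚ]`: `Fact_weilLine_rank`). [folklore] -/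
def weilLine (K : CMField) (Φ : Fin 4 → CMType K) : Submodule ℚ (U.Coh (U.prod4 K Φ) 4) :=
  ((Submodule.span ℂ (U.weilGenerators K Φ)).restrictScalars ℚ).comap ofRat

/-- `W_K(P(f))` is algebraic, for the product `P(f)` of the four corners of the face `f`
(the conclusion of rfwf Thm 1.3 for one face). [folklore] -/
def WeilFaceAlgebraic (K : CMField) (f : Face K) : Prop :=
  U.weilLine K f.corner ≤ U.alg (U.prod4 K f.corner) 2

/-! ### Picard modular surfaces: isotypic holomorphic one-forms -/

/-- `U_Ψ(Γ)`: the span in `H¹(P_Γ, ℂ)` of the pullbacks `F^*α` over all morphisms `F : P_Γ → A_{(K,Ψ)}`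
and all holomorphic `ι₁`-eigen one-forms `α` — PerL's "`B_t`-isotypic, `φ₁`-eigen part of `H^{1,0}(P_Γ)`"
(typing-check-perL.md; [Y1neg] v2 §8). Here `K` may differ from the field `L` of the surface
(PerL: `K` sextic, `L = K̃`). [folklore] -/
def Uiso {L : CMField} {ι₁ : L →+* ℂ} {V : HermSpace3 L ι₁} (Γ : Level V)
    (K : CMField) (Ψ : CMType K) (σ : K →+* ℂ) : Submodule ℂ (U.CohC (U.pms L ι₁ V Γ) 1) :=
  Submodule.span ℂ {ω | ∃ (F : U.Mor (U.pms L ι₁ V Γ) (U.cmAV K Ψ)) (α : U.CohC (U.cmAV K Ψ) 1),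
    α ∈ U.alphaLine K Ψ σ ∧ ω = U.pullC F 1 α}

end Universe

end Summit.HodgeConjecture.CorCM

end
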